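import Summits.ValiantsHypothesis.ValiantsHypothesis.Theorems.KPlusLogSqLawStaticPathGapChargingSweep
import Summits.ValiantsHypothesis.ValiantsHypothesis.Theorems.KPlusLogSqLawStaticPathEvents
import Summits.ValiantsHypothesis.ValiantsHypothesis.Theorems.KPlusLogSqLawStaticPathUnique

/-!
# Route «KPlusLogSqLaw» — parametric max-weight independent set on a path: OPTIMUM CHANGES ≤ n + 2 · RECORD CHANGES along every sweep

HONEST FRAMING.  Helper toward the crux `WeakLifting` (item `stmt-ValiantsHypothesis-19561`, route `KPlusLogSqLaw`, cell `pub-symmetroid`,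
seat val-sym-lift-p4 g24, 2026-08-29) on the line of its witness-plan stub `stub_tridiagonalSectorB` (tropical twin of the STATIC tridiagonal
sector = parametric maximum-weight independent set on a path; located theory `HOME/val-sym-lift-p4/SILENT-FLIP-LAW.md`).  Consumer form
of `…StaticPathGapChargingSweep`: along a DISCRETE SWEEP `θ 0, …, θ T` of the prefix-sum arrangement of the block `i+1, …, i+n` (between
consecutive parameters only the pair `(S_{x k}, S_{y k})`, `x k < y k ≤ n`, may change order; pairwise distinct values at every `θ k`; the pair
adjacent at `θ k`; each pair REVERSES its order at most once — automatic for lines met in increasing parameter order), if `M k` is an optimal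
independent set at `θ k` for every `k ≤ T`, then the number of steps at which the optimum changes is at most `n` plus twice the number of pairs
`(k, z)`, `k < T`, `z ≤ n`, at which `z` changes its RECORD status (left touch or right touch of the two alternating folds)
(`card_changes_le_of_sweep`): by the event test `ne_iff_event` a change of the optimum is an event step in the sense of (F2)
(`event_iff_records`), across which no record changes (`records_iff_of_step`), and the gap-charging lemma applies.  This is THEOREM A of the
memo in the kernel in its one-for-two form `#breakpoints ≤ n + 2 · #silent flips` for every allowable sweep; the sharp one-for-one form is not
claimed here.  Statements about a path DP; nothing here asserts anything about `WeakLifting`, `TropicalB`, `KPlusLogSqLaw`, the stub in its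
window, `MatrixDescartes` (stmt-ValiantsHypothesis-18050) or `VP ≠ VNP`; the ORDER QUESTION stays open.
-/

set_option linter.dupNamespace false
set_option autoImplicit false

namespace Summit.ValiantsHypothesis.ValiantsHypothesis.Theorems.KPlusLogSqLaw

open Finset Classical

namespace StaticPathFold

noncomputable section

section Opt

variable (w₁ w₀ : ℕ → ℝ)

/-- **OPTIMUM CHANGES ≤ n + 2 · RECORD CHANGES ALONG A DISCRETE SWEEP** (`HOME/val-sym-lift-p4/SILENT-FLIP-LAW.md`, Theorem A in the form
`E ≤ n + 2M`, for every allowable sweep of the prefix-sum arrangement). [folklore] -/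
theorem card_changes_le_of_sweep (i n T : ℕ) (θ : ℕ → ℝ) (x y : ℕ → ℕ) (M : ℕ → Finset ℕ)
    (hxy : ∀ k, k < T → x k < y k ∧ y k ≤ n)
    (hord : ∀ k, k < T → ∀ p q, p ≤ n → q ≤ n → ¬(p = x k ∧ q = y k) → ¬(p = y k ∧ q = x k) →
      (L (altA (shift i w₁)) (altB (shift i w₀)) p (θ k) < L (altA (shift i w₁)) (altB (shift i w₀)) q (θ k) ↔
        L (altA (shift i w₁)) (altB (shift i w₀)) p (θ (k + 1)) < L (altA (shift i w₁)) (altB (shift i w₀)) q (θ (k + 1))))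
    (hdis : ∀ k, k ≤ T → ∀ p q, p ≤ n → q ≤ n → p ≠ q →
      L (altA (shift i w₁)) (altB (shift i w₀)) p (θ k) ≠ L (altA (shift i w₁)) (altB (shift i w₀)) q (θ k))
    (hadj : ∀ k, k < T → ∀ z, z ≤ n → z ≠ x k → z ≠ y k →
      (L (altA (shift i w₁)) (altB (shift i w₀)) z (θ k) < L (altA (shift i w₁)) (altB (shift i w₀)) (x k) (θ k) ↔
        L (altA (shift i w₁)) (altB (shift i w₀)) z (θ k) < L (altA (shift i w₁)) (altB (shift i w₀)) (y k) (θ k)))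
    (honce : ∀ k, k < T → ∀ k', k' < T → x k = x k' → y k = y k' →
      (L (altA (shift i w₁)) (altB (shift i w₀)) (x k) (θ k) < L (altA (shift i w₁)) (altB (shift i w₀)) (y k) (θ k) ↔
        ¬ L (altA (shift i w₁)) (altB (shift i w₀)) (x k) (θ (k + 1)) < L (altA (shift i w₁)) (altB (shift i w₀)) (y k) (θ (k + 1))) →
      (L (altA (shift i w₁)) (altB (shift i w₀)) (x k') (θ k') < L (altA (shift i w₁)) (altB (shift i w₀)) (y k') (θ k') ↔
        ¬ L (altA (shift i w₁)) (altB (shift i w₀)) (x k') (θ (k' + 1)) < L (altA (shift i w₁)) (altB (shift i w₀)) (y k') (θ (k' + 1))) →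
      k = k')
    (hM : ∀ k, k ≤ T → M k ∈ indepSets i n)
    (hopt : ∀ k, k ≤ T → ∑ t ∈ M k, W w₁ w₀ t (θ k) = opt w₁ w₀ i n (θ k)) :
    ((range T).filter (fun k => M k ≠ M (k + 1))).card ≤
      n + 2 * (((range T) ×ˢ (range (n + 1))).filter (fun kz : ℕ × ℕ =>
        ¬ ((fold (altA (shift i w₁)) (altB (shift i w₀)) kz.2 (θ kz.1) = L (altA (shift i w₁)) (altB (shift i w₀)) kz.2 (θ kz.1) ∨
              fold (altA (shift 0 (rev i n w₁))) (altB (shift 0 (rev i n w₀))) (n - kz.2) (θ kz.1) =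
                L (altA (shift 0 (rev i n w₁))) (altB (shift 0 (rev i n w₀))) (n - kz.2) (θ kz.1)) ↔
            (fold (altA (shift i w₁)) (altB (shift i w₀)) kz.2 (θ (kz.1 + 1)) =
                L (altA (shift i w₁)) (altB (shift i w₀)) kz.2 (θ (kz.1 + 1)) ∨
              fold (altA (shift 0 (rev i n w₁))) (altB (shift 0 (rev i n w₀))) (n - kz.2) (θ (kz.1 + 1)) =
                L (altA (shift 0 (rev i n w₁))) (altB (shift 0 (rev i n w₀))) (n - kz.2) (θ (kz.1 + 1)))))).card := by
  set A := altA (shift i w₁) with hA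
  set B := altB (shift i w₀) with hB
  set A' := altA (shift 0 (rev i n w₁)) with hA'
  set B' := altB (shift 0 (rev i n w₀)) with hB'
  -- the record process and the steps at which the optimum changes
  set N : ℕ → Finset ℕ := fun k => (range (n + 1)).filter (fun u =>
    fold A B u (θ k) = L A B u (θ k) ∨ fold A' B' (n - u) (θ k) = L A' B' (n - u) (θ k)) with hN
  set Ev := (range T).filter (fun k => M k ≠ M (k + 1)) with hEv
  have hmemN : ∀ k u, u ∈ N k ↔ (u ≤ n ∧ (fold A B u (θ k) = L A B u (θ k) ∨ fold A' B' (n - u) (θ k) = L A' B' (n - u) (θ k))) := by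
    intro k u
    rw [hN, mem_filter, mem_range, Nat.lt_succ_iff]
  -- at a step where the optimum changes: the event test, in both forms
  have hev : ∀ k ∈ Ev,
      k < T ∧
      (L A B (x k) (θ k) < L A B (y k) (θ k) ↔ ¬ L A B (x k) (θ (k + 1)) < L A B (y k) (θ (k + 1))) ∧
      fold A B (x k) (θ k) = L A B (x k) (θ k) ∧ fold A' B' (n - y k) (θ k) = L A' B' (n - y k) (θ k) ∧
      ∀ z, x k < z → z < y k → fold A B z (θ k) ≠ L A B z (θ k) ∧ fold A' B' (n - z) (θ k) ≠ L A' B' (n - z) (θ k) := by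
    intro k hk
    obtain ⟨hkT, hne⟩ := mem_filter.mp hk
    rw [mem_range] at hkT
    obtain ⟨hxy1, hyn⟩ := hxy k hkT
    have huniq := unique_of_distinct w₁ w₀ (hdis k hkT.le) (hM k hkT.le) (hopt k hkT.le)
    have huniq' := unique_of_distinct w₁ w₀ (hdis (k + 1) (by omega)) (hM (k + 1) (by omega)) (hopt (k + 1) (by omega))
    obtain ⟨hflip, hL, hI, hR⟩ := (ne_iff_event w₁ w₀ hxy1 hyn (hM k hkT.le) (hM (k + 1) (by omega)) huniq huniq'
      (hord k hkT) (hdis k hkT.le) (hdis (k + 1) (by omega)) (hadj k hkT)).mp hne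
    obtain ⟨-, -, hno⟩ := (event_iff_records w₁ w₀ hxy1 hyn (hdis k hkT.le) (hadj k hkT)).mp ⟨hL, hI, hR⟩
    exact ⟨hkT, hflip, hL, hR, hno⟩
  -- the three hypotheses of the gap-charging lemma
  have h1 : ∀ k ∈ Ev, k < T ∧ x k < y k ∧ y k ≤ n ∧ x k ∈ N k ∧ y k ∈ N k ∧ ∀ z, x k < z → z < y k → z ∉ N k := by
    intro k hk
    obtain ⟨hkT, -, hL, hR, hno⟩ := hev k hk
    obtain ⟨hxy1, hyn⟩ := hxy k hkT
    refine ⟨hkT, hxy1, hyn, (hmemN k (x k)).mpr ⟨by omega, Or.inl hL⟩, (hmemN k (y k)).mpr ⟨hyn, Or.inr hR⟩,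
      fun z hz1 hz2 hz => ?_⟩
    obtain ⟨-, h | h⟩ := (hmemN k z).mp hz
    · exact (hno z hz1 hz2).1 h
    · exact (hno z hz1 hz2).2 h
  have h2 : ∀ k ∈ Ev, N (k + 1) = N k := by
    intro k hk
    obtain ⟨hkT, -, hL, hR, -⟩ := hev k hk
    obtain ⟨hxy1, hyn⟩ := hxy k hkT
    ext u
    rw [hmemN, hmemN]
    constructor
    · rintro ⟨hu, h⟩
      exact ⟨hu, (records_iff_of_step w₁ w₀ hxy1 hyn (hord k hkT) (hdis k hkT.le) (hdis (k + 1) (by omega)) (hadj k hkT)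
        hL hR hu).mp h⟩
    · rintro ⟨hu, h⟩
      exact ⟨hu, (records_iff_of_step w₁ w₀ hxy1 hyn (hord k hkT) (hdis k hkT.le) (hdis (k + 1) (by omega)) (hadj k hkT)
        hL hR hu).mpr h⟩
  have h3 : ∀ k ∈ Ev, ∀ k' ∈ Ev, x k = x k' → y k = y k' → k = k' := by
    intro k hk k' hk' hx hy
    obtain ⟨hkT, hflip, -⟩ := hev k hk
    obtain ⟨hk'T, hflip', -⟩ := hev k' hk'
    exact honce k hkT k' hk'T hx hy hflip hflip'
  have hmain := card_events_le_add_two_mul_card_changes (n := n) (T := T) (N := N) (x := x) (y := y) (Ev := Ev) h1 h2 h3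
  -- identify the change sets
  have hMset : ((range T) ×ˢ (range (n + 1))).filter (fun kz : ℕ × ℕ => ¬ (kz.2 ∈ N kz.1 ↔ kz.2 ∈ N (kz.1 + 1))) =
      ((range T) ×ˢ (range (n + 1))).filter (fun kz : ℕ × ℕ =>
        ¬ ((fold A B kz.2 (θ kz.1) = L A B kz.2 (θ kz.1) ∨ fold A' B' (n - kz.2) (θ kz.1) = L A' B' (n - kz.2) (θ kz.1)) ↔
            (fold A B kz.2 (θ (kz.1 + 1)) = L A B kz.2 (θ (kz.1 + 1)) ∨
              fold A' B' (n - kz.2) (θ (kz.1 + 1)) = L A' B' (n - kz.2) (θ (kz.1 + 1))))) := by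
    refine filter_congr (fun kz hkz => ?_)
    obtain ⟨-, hz⟩ := mem_product.mp hkz
    have hzn : kz.2 ≤ n := by have := mem_range.mp hz; omega
    rw [hmemN, hmemN]
    simp only [hzn, true_and]
  rw [hMset] at hmain
  exact hmain

end Opt

end

end StaticPathFold

end Summit.ValiantsHypothesis.ValiantsHypothesis.Theorems.KPlusLogSqLaw
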